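import Summits.BirchSwinnertonDyer.BirchSwinnertonDyer.Theses.TameQuarticManinParity
import Summits.BirchSwinnertonDyer.BirchSwinnertonDyer.Theorems.TameQuarticManinParityOrientationOfPeriodSaturation
import Summits.BirchSwinnertonDyer.BirchSwinnertonDyer.Theorems.TameQuarticManinParityPeriodSaturationOfModThreeSaturation
import HarnessLib

/-!
# Route `TameQuarticManinParity`, LINE 28b (bsd-idea-3 g8): O22 `TprimeIrrTwistLatticeOrientation`
# (stmt-BirchSwinnertonDyer-28139) ⇐ MS `TprimeIrrModThreeSaturation` (stmt-BirchSwinnertonDyer-23367), BY NAME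

Seat `bsd-line-tqmp-g28-p1` g1 (prover; director-bsd (280)(b), critic idea-crit-5 VERDICT #167 PASS-WITH-PRICE /
NOTE #170), landing the composition of the planner-of-record's scratch `O22_of_MS.lean` (bsd-idea-3 HOME `ideas/l28/`,
sha16 `46dc5b029d3b456f`). THEOREMS ONLY (no definition, no named fact, no `sorry`; axioms `propext`,
`Classical.choice`, `Quot.sound`). This by-name glue is the only part that must import the route file and the landed
G28 module; the mathematics (`PS_of`) sits route-independently in
`TameQuarticManinParityPeriodSaturationOfModThreeSaturation`. CREDIT RULE: GLUE — O22 (stmt-28139) stays OPEN, its open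
content being exactly MS (stmt-23367: the mod-`3` saturation of the twisted eigen-system, to come from
(L1c)+(L2)+W23b); B23 is not advanced; no summit is proved; BSD is NOT proved by this file.

## Content

* `tprimeIrrTwistLatticeOrientation_of_tprimeIrrModThreeSaturation` — **O22 ⇐ MS, both route decls by name**: MS
  supplies a finite set `S` of primes `≠ 3`, integers `a_p`, the eigen-equations `T_p f* = a_p f*` for
  `f* = D.f ⊗ χ₋₃` and the mod-`3` saturation of `ā` on `V₁(𝔽₃)`; `psOfShape_proof` turns them into period
  saturation `PS(f*)`; the landed G28 `tprimeIrrOrientationOfPeriodSaturation_proof` (stmt-BirchSwinnertonDyer-23285)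
  turns `PS(f*)` into `Λ(D.f) ⊆ g(χ₋₃)·Λ(f*)`, O22's conclusion verbatim.
-/

set_option autoImplicit false
-- D-0017: single-problem summit, so `Summit.BirchSwinnertonDyer.BirchSwinnertonDyer.…` repeats a namespace BY DESIGN.
set_option linter.dupNamespace false

noncomputable section

namespace Summit.BirchSwinnertonDyer.BirchSwinnertonDyer.Theorems.TameQuarticManinParity

open Summit.BirchSwinnertonDyer.BirchSwinnertonDyer.Theses.TameQuarticManinParity

section ByName

/-- **O22 ⇐ MS, by name**: `TprimeIrrModThreeSaturation` (stmt-BirchSwinnertonDyer-23367) implies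
`TprimeIrrTwistLatticeOrientation` (O22, stmt-BirchSwinnertonDyer-28139). For a Kodaira-III curve `W` in the tame
quartic class with irreducible `ρ̄_{W,3}`, datum `D`, `9 ∣ N_W`, `χ = χ₋₃` and `f* = D.f ⊗ χ`: MS gives a finite set `S`
of primes `≠ 3`, integer eigenvalues `T_p f* = a_p f*` (`p ∈ S`) and the mod-`3` saturation of `ā` on `V₁(𝔽₃)`;
`psOfShape_proof` yields period saturation of `f*`; the landed G28 `tprimeIrrOrientationOfPeriodSaturation_proof`
(stmt-BirchSwinnertonDyer-23285) yields `Λ(D.f) ⊆ g(χ)·Λ(f*)`. Glue only: O22 remains open (its content is MS);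
BSD is not proved by this. [cite: Jacobson1989BasicAlgebraII, §3.4 Fitting's lemma (38), p. 113 (derived reading, see `psOfShape_proof`)] [cite: Stevens1989, Lemma (5.4)] -/
theorem tprimeIrrTwistLatticeOrientation_of_tprimeIrrModThreeSaturation
    (hMS : TprimeIrrModThreeSaturation) : TprimeIrrTwistLatticeOrientation := by
  unfold TprimeIrrTwistLatticeOrientation
  intro W _ _ _ hCM hA hS hirr hv D h9 χ hχ hprim
  obtain ⟨S, a, heig, hsat⟩ := hMS W hCM hA hS hirr hv D h9 χ hχ hprim
  exact tprimeIrrOrientationOfPeriodSaturation_proof W hCM hA hS hirr hv D h9 χ hχ hprim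
    (psOfShape_proof (W.conductorNorm ℤ) h9 _ S a heig hsat)

end ByName

end Summit.BirchSwinnertonDyer.BirchSwinnertonDyer.Theorems.TameQuarticManinParity

end
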